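import Literature.Combinatorics.SimpleGraph.FormulaCells
import Literature.Combinatorics.SimpleGraph.HamiltonianDiamondChain
import HarnessLib

/-!
# The `#3SAT → #HamPath` construction, I: layout (indices, slots, numbering)

Bookkeeping for a planar variant of the reduction of Liśkiewicz–Ogihara–Toda 2003, Lemma 4
(`#3SAT ≤ᵖ_{r-shift} #HamPath` for planar graphs of maximum degree three), organised for the
formal proof: the skeleton is ONE diamond chain (`HamiltonianDiamondChain.lean`), every
constraint is a gadget substituted at chain slot edges (`HamiltonianIteratedSubstitution.lean`),
and the only crossings are Garey–Johnson–Tarjan's crossings of exclusive-or lines through the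
two-node cycles ("diamonds") on the rungs of a diamond ladder (`HamiltonianDiamondLadder.lean`,
LOT2003 Fig. 2 (b)), which the refined substitution identity
(`HamiltonianGadgetSubstitutionRefined.lean`) accounts for.

For a CNF `φ` with `N` cells (literal occurrences, `FormulaCells.lean`) the chain has
`M = 2N + N(2N+1) + N + 1` cells, in this order:

* `2N` **dummy cells** `D_c = 2c`, `D'_c = 2c+1` (pinned; they cap the columns),
* `N` **rows**, row `r` (the bus of cell `r`: its value is the value of the variable of cell `r`)
  consisting of `2N+1` cells `B_{r,0} W_{r,0} B_{r,1} … W_{r,N-1} B_{r,N}` — the **chain-site**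
  `(r, j)` is `Bl = B_{r,j}`, `W = W_{r,j}` (the "door"), `Br = B_{r,j+1}`; rows alternate
  direction in the plane, so the site of **column** `c` in row `r` is `j = J r c`
  (`c` for odd `r`, `N-1-c` for even `r`);
* `N` **clause cells** `K_c`, and one free cell `Z`.

Gadgets (all numbered after the `5M` chain vertices, in blocks): stage 1 — a diamond ladder
`DL(r, j)` on `(Bl.UR, Br.UL)` at every site (the bus: `Bl = Br`), one-input OR pins on the dummy
cells, the clause gadgets (`OR1` on `K_0`, `OR3` on consecutive triples); stage 2 — per column `c`
and row `r` five exclusive-or ladders `h₀ … h₄` (the wire of column `c` enters the site from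
`above r c`, hops through the four rung diamonds of `DL(r, J r c)`, and opens the door `W.UL`),
leaving below through `below r c` (`W.LL`, or the tap `Bl.LR` in the rows `r = c` and
`r = prev c`), the set ladder of column `c` (`W.LL – Br.LL` at site `(c, J c c)` if the variable
of `c` occurred before, else a vacuous ladder on the dummies), and the link into `K_c.UL`. All
slot ends of a site lie in the closed column strip between the centres of `Bl` and `Br` (the
grid drawing, part III, is assembled from per-strip stamps).

This file fixes the arithmetic of all these indices and proves the bounds and distinctness facts
used by the validity of the gadget families (part II) and by the grid drawing (part III).

## References

* M. Liśkiewicz, M. Ogihara, S. Toda, TCS 304 (2003) 129–156, §3 (Lemma 4, Figs. 2, 4, 5).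
* M. R. Garey, D. S. Johnson, R. E. Tarjan, SIAM J. Comput. 5 (1976) 704–714, §2.
-/

namespace Literature.Combinatorics.SimpleGraph

namespace LOTReduction

open Literature.Computability.Complexity

variable (φ : CNF ℕ)

/-! ### Sizes -/

/-- The number of cells of the formula. [folklore] -/
abbrev N : ℕ := FormulaCells.N φ

/-- The number of chain cells: dummies, rows, clause cells, the free cell. [folklore] -/
def M : ℕ := 2 * N φ + N φ * (2 * N φ + 1) + N φ + 1

/-- The chain is nonempty. [folklore] -/
theorem M_pos : 0 < M φ := by unfold M; omega

/-! ### Cell indices -/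

/-- The dummy cell `D_c`. [folklore] -/
def dIdx (c : ℕ) : ℕ := 2 * c

/-- The dummy cell `D'_c`. [folklore] -/
def d'Idx (c : ℕ) : ℕ := 2 * c + 1

/-- The first cell of row `r`. [folklore] -/
def rowStart (r : ℕ) : ℕ := 2 * N φ + r * (2 * N φ + 1)

/-- Cell `k` of row `r` (`k ≤ 2N`). [folklore] -/
def rowCell (r k : ℕ) : ℕ := rowStart φ r + k

/-- The clause cell `K_c`. [folklore] -/
def kIdx (c : ℕ) : ℕ := 2 * N φ + N φ * (2 * N φ + 1) + c

/-- The free cell `Z` (the last cell). [folklore] -/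
def zIdx : ℕ := 2 * N φ + N φ * (2 * N φ + 1) + N φ

/-- The left bus cell `Bl` of site `(r, j)`. [folklore] -/
def blIdx (r j : ℕ) : ℕ := rowCell φ r (2 * j)

/-- The door `W` of site `(r, j)`. [folklore] -/
def wIdx (r j : ℕ) : ℕ := rowCell φ r (2 * j + 1)

/-- The right bus cell `Br` of site `(r, j)`. [folklore] -/
def brIdx (r j : ℕ) : ℕ := rowCell φ r (2 * j + 2)

/-- **The site of column `c` in row `r`**: rows alternate direction. [folklore] -/
def J (r c : ℕ) : ℕ := if r % 2 = 1 then c else N φ - 1 - c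

/-! ### Slot edges of a cell (the four slot edges of the diamond `p a b q` of cell `i`) -/

/-- `UL = p a` (used iff the state is `true`). [folklore] -/
def slUL (i : ℕ) : ℕ × ℕ := (5 * i + 1, 5 * i + 2)

/-- `UR = a q` (used iff the state is `false`). [folklore] -/
def slUR (i : ℕ) : ℕ × ℕ := (5 * i + 2, 5 * i + 4)

/-- `LL = p b` (used iff the state is `false`). [folklore] -/
def slLL (i : ℕ) : ℕ × ℕ := (5 * i + 1, 5 * i + 3)

/-- `LR = b q` (used iff the state is `true`). [folklore] -/
def slLR (i : ℕ) : ℕ × ℕ := (5 * i + 3, 5 * i + 4)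

/-! ### Previous occurrences, taps, the wire's way through a site -/

/-- **The previous occurrence** of the variable of cell `c`, if any. [folklore] -/
def prev? (c : ℕ) : Option ℕ :=
  ((List.range c).filter fun d => FormulaCells.varOf φ d = FormulaCells.varOf φ c).getLast?

/-- **Row `r` taps the bus for column `c`**: `r = c` (the literal wire starts) or `r` is the
previous occurrence (the consistency wire starts). [folklore] -/
def IsTap (r c : ℕ) : Prop := r = c ∨ prev? φ c = some r

/-- Tapping is decidable. [folklore] -/
instance (r c : ℕ) : Decidable (IsTap φ r c) := by unfold IsTap; infer_instance

/-- **The slot through which the wire of column `c` leaves row `r` downwards**: the tap `Bl.LR`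
(used iff the bus is `true`) in the tap rows, else the door's exit `W.LL`. [folklore] -/
def below (r c : ℕ) : ℕ × ℕ :=
  if IsTap φ r c then slLR (blIdx φ r (J φ r c)) else slLL (wIdx φ r (J φ r c))

/-- **The slot from which the wire of column `c` enters row `r`** (the dummy `D_c` caps row `0`).
[folklore] -/
def above (r c : ℕ) : ℕ × ℕ :=
  if r = 0 then slLL (dIdx c) else below φ (r - 1) c

/-! ### Numbering of the gadget blocks -/

/-- First gadget vertex (after the `5M` chain vertices). [folklore] -/
def base1 : ℕ := 5 * M φ

/-- Block of the diamond ladder of site `(r, j)` (24 vertices). [folklore] -/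
def dlBase (r j : ℕ) : ℕ := base1 φ + 24 * (r * N φ + j)

/-- Block of the pin on dummy cell `i < 2N` (3 vertices). [folklore] -/
def pinBase (i : ℕ) : ℕ := base1 φ + 24 * (N φ * N φ) + 3 * i

/-- Block of the unit-clause gadget on `K_0` (3 vertices). [folklore] -/
def clause1Base : ℕ := base1 φ + 24 * (N φ * N φ) + 6 * N φ

/-- Number of three-literal clauses. [folklore] -/
def T : ℕ := (N φ - 1) / 3

/-- Block of the gadget of three-literal clause `j < T` (27 vertices). [folklore] -/
def or3Base (j : ℕ) : ℕ := clause1Base φ + 3 + 27 * j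

/-- Number of stage-1 gadgets. [folklore] -/
def n₁ : ℕ := N φ * N φ + 2 * N φ + 1 + T φ

/-- First stage-2 vertex. [folklore] -/
def base2 : ℕ := clause1Base φ + 3 + 27 * T φ

/-- Block of hop ladder `h` of column `c` in row `r` (12 vertices). [folklore] -/
def hopBase (c r h : ℕ) : ℕ := base2 φ + 12 * (5 * (c * N φ + r) + h)

/-- Block of the set ladder of column `c` (12 vertices). [folklore] -/
def setBase (c : ℕ) : ℕ := base2 φ + 60 * (N φ * N φ) + 12 * c

/-- Block of the link of column `c` into its clause cell (12 vertices). [folklore] -/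
def klinkBase (c : ℕ) : ℕ := base2 φ + 60 * (N φ * N φ) + 12 * N φ + 12 * c

/-- Number of stage-2 gadgets. [folklore] -/
def n₂ : ℕ := 5 * (N φ * N φ) + 2 * N φ

/-- Total number of vertices. [folklore] -/
def totalV : ℕ := base2 φ + 60 * (N φ * N φ) + 24 * N φ

/-- The hop edge `pₖ aₖ` of diamond `k` of `DL(r, j)` (used in state A). [folklore] -/
def hopUL (r j k : ℕ) : ℕ × ℕ := (dlBase φ r j + (8 + 4 * k), dlBase φ r j + (9 + 4 * k))

/-- The hop edge `pₖ bₖ` of diamond `k` of `DL(r, j)` (used in state B). [folklore] -/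
def hopLL (r j k : ℕ) : ℕ × ℕ := (dlBase φ r j + (8 + 4 * k), dlBase φ r j + (10 + 4 * k))

/-! ### The slots of the stage-2 gadgets -/

/-- Slots of the hop ladder `h` of column `c` in row `r`: `h₀ = (above, UL₀)`,
`hₖ = (LL_{k-1}, ULₖ)` for `1 ≤ k ≤ 3`, `h₄ = (LL₃, W.UL)`. [cite: LiskiewiczOgiharaToda2003, §3, Fig. 2 (b)] -/
def hopSlots (c r h : ℕ) : (ℕ × ℕ) × (ℕ × ℕ) :=
  if h = 0 then (above φ r c, hopUL φ r (J φ r c) 0)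
  else if h = 4 then (hopLL φ r (J φ r c) 3, slUL (wIdx φ r (J φ r c)))
  else (hopLL φ r (J φ r c) (h - 1), hopUL φ r (J φ r c) h)

/-- Slots of the set ladder of column `c`: `W.LL – Br.LL` at site `(c, J c c)` if the variable
occurred before (the wire arriving there carries the bus of the previous occurrence `p`; the door
is then `W = ¬ bus_p`, and "exactly one of `W.LL` (used iff `W` false), `Br.LL` (used iff `Br`
false)" is `bus_c = bus_p`), else the vacuous pair `D_c.LR – D'_c.UR` (exactly one of them is used
under the pins). [folklore] -/
def setSlots (c : ℕ) : (ℕ × ℕ) × (ℕ × ℕ) :=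
  if (prev? φ c).isSome then (slLL (wIdx φ c (J φ c c)), slLL (brIdx φ c (J φ c c)))
  else (slLR (dIdx c), slUR (d'Idx c))

/-- Slots of the link of column `c` into `K_c`. [folklore] -/
def klinkSlots (c : ℕ) : (ℕ × ℕ) × (ℕ × ℕ) :=
  (below φ (N φ - 1) c, slUL (kIdx φ c))

/-- The slot of `K_c` read by its clause gadget: `LL` for a positive literal, `LR` for a negative
one — the wire delivers the NEGATION of the bus to `K_c` (the link into `K_c.UL` inverts once
more than the doors), so "slot used" is "literal true". [cite: LiskiewiczOgiharaToda2003, §3 (OR-gadget inputs)] -/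
def litSlot (c : ℕ) : ℕ × ℕ :=
  if FormulaCells.polOf φ c then slLL (kIdx φ c) else slLR (kIdx φ c)

/-! ### Bounds -/

variable {φ}

/-- Consecutive rows start `2N+1` cells apart. [folklore] -/
theorem rowStart_succ (r : ℕ) : rowStart φ (r + 1) = rowStart φ r + (2 * N φ + 1) := by
  unfold rowStart; ring

/-- Dummy cells come first. [folklore] -/
theorem dIdx_lt {c : ℕ} (hc : c < N φ) : dIdx c < 2 * N φ := by unfold dIdx; omega

/-- Dummy cells come first. [folklore] -/
theorem d'Idx_lt {c : ℕ} (hc : c < N φ) : d'Idx c < 2 * N φ := by unfold d'Idx; omega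

/-- Row cells lie between the dummies and the clause cells. [folklore] -/
theorem rowCell_lt {r k : ℕ} (hr : r < N φ) (hk : k ≤ 2 * N φ) :
    rowCell φ r k < 2 * N φ + N φ * (2 * N φ + 1) := by
  unfold rowCell rowStart
  have : r * (2 * N φ + 1) + k < N φ * (2 * N φ + 1) := by
    calc r * (2 * N φ + 1) + k < r * (2 * N φ + 1) + (2 * N φ + 1) := by omega
      _ = (r + 1) * (2 * N φ + 1) := by ring
      _ ≤ N φ * (2 * N φ + 1) := Nat.mul_le_mul_right _ hr
  omega

/-- Row cells come after the dummies. [folklore] -/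
theorem le_rowCell (r k : ℕ) : 2 * N φ ≤ rowCell φ r k := by unfold rowCell rowStart; omega

/-- Clause cells come after the rows. [folklore] -/
theorem le_kIdx (c : ℕ) : 2 * N φ + N φ * (2 * N φ + 1) ≤ kIdx φ c := by unfold kIdx; omega

/-- Clause cells are cells. [folklore] -/
theorem kIdx_lt {c : ℕ} (hc : c < N φ) : kIdx φ c < zIdx φ := by unfold kIdx zIdx; omega

/-- The free cell is the last cell. [folklore] -/
theorem zIdx_eq : zIdx φ = M φ - 1 := by unfold zIdx M; omega

/-- The free cell is a cell. [folklore] -/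
theorem zIdx_lt : zIdx φ < M φ := by unfold zIdx M; omega

/-- Row cells are cells. [folklore] -/
theorem rowCell_lt_M {r k : ℕ} (hr : r < N φ) (hk : k ≤ 2 * N φ) : rowCell φ r k < M φ := by
  have := rowCell_lt hr hk; unfold M; omega

/-- Dummies are cells. [folklore] -/
theorem dIdx_lt_M {c : ℕ} (hc : c < N φ) : dIdx c < M φ := by have := dIdx_lt hc; unfold M; omega

/-- Dummies are cells. [folklore] -/
theorem d'Idx_lt_M {c : ℕ} (hc : c < N φ) : d'Idx c < M φ := by have := d'Idx_lt hc; unfold M; omega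

/-- Clause cells are cells. [folklore] -/
theorem kIdx_lt_M {c : ℕ} (hc : c < N φ) : kIdx φ c < M φ := (kIdx_lt hc).trans zIdx_lt

/-- `rowCell` is injective in the pair `(r, k)` for `k ≤ 2N`. [folklore] -/
theorem rowCell_inj {r k r' k' : ℕ} (hk : k ≤ 2 * N φ) (hk' : k' ≤ 2 * N φ)
    (h : rowCell φ r k = rowCell φ r' k') : r = r' ∧ k = k' := by
  unfold rowCell rowStart at h
  have h1 : r * (2 * N φ + 1) + k = r' * (2 * N φ + 1) + k' := by omega
  have hr : r = r' := by
    have e1 := Nat.div_add_mod (r * (2 * N φ + 1) + k) (2 * N φ + 1)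
    have q : (r * (2 * N φ + 1) + k) / (2 * N φ + 1) = r := by
      rw [Nat.add_comm, Nat.add_mul_div_right _ _ (by omega), Nat.div_eq_of_lt (by omega)]; simp
    have q' : (r' * (2 * N φ + 1) + k') / (2 * N φ + 1) = r' := by
      rw [Nat.add_comm, Nat.add_mul_div_right _ _ (by omega), Nat.div_eq_of_lt (by omega)]; simp
    rw [← q, ← q', h1]
  subst hr
  exact ⟨rfl, by omega⟩

/-- The site index of a column is a site index. [folklore] -/
theorem J_lt {r c : ℕ} (hc : c < N φ) : J φ r c < N φ := by unfold J; split_ifs <;> omega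

/-- `J r` is an involution on columns. [folklore] -/
theorem J_J {r c : ℕ} (hc : c < N φ) : J φ r (J φ r c) = c := by unfold J; split_ifs <;> omega

/-- `J r` is injective on columns. [folklore] -/
theorem J_inj {r c c' : ℕ} (hc : c < N φ) (hc' : c' < N φ) (h : J φ r c = J φ r c') : c = c' := by
  rw [← J_J (r := r) hc, ← J_J (r := r) hc', h]

/-! ### The slot edges are chain edges with increasing ends -/

/-- The four slot edges of cell `i` go up. [folklore] -/
theorem slUL_fst_lt (i : ℕ) : (slUL i).1 < (slUL i).2 := by simp [slUL]
/-- `UR` goes up. [folklore] -/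
theorem slUR_fst_lt (i : ℕ) : (slUR i).1 < (slUR i).2 := by simp [slUR]
/-- `LL` goes up. [folklore] -/
theorem slLL_fst_lt (i : ℕ) : (slLL i).1 < (slLL i).2 := by simp [slLL]
/-- `LR` goes up. [folklore] -/
theorem slLR_fst_lt (i : ℕ) : (slLR i).1 < (slLR i).2 := by simp [slLR]

/-- Slot edges of cells are edges of the chain. [folklore] -/
theorem chainG_adj_slUL {Mc i : ℕ} (hi : i < Mc) : (chainG Mc).Adj (slUL i).1 (slUL i).2 := by
  rw [chainG_adj, slUL]
  refine ⟨by simp, Or.inl (chainRelB_iff.2 ⟨by omega, Or.inr (Or.inl ⟨by omega, Or.inl rfl⟩)⟩)⟩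

/-- `UR` is a chain edge. [folklore] -/
theorem chainG_adj_slUR {Mc i : ℕ} (hi : i < Mc) : (chainG Mc).Adj (slUR i).1 (slUR i).2 := by
  rw [chainG_adj, slUR]
  refine ⟨by simp, Or.inl (chainRelB_iff.2 ⟨by omega, Or.inr (Or.inr (Or.inl ⟨by omega, Or.inr rfl⟩))⟩)⟩

/-- `LL` is a chain edge. [folklore] -/
theorem chainG_adj_slLL {Mc i : ℕ} (hi : i < Mc) : (chainG Mc).Adj (slLL i).1 (slLL i).2 := by
  rw [chainG_adj, slLL]
  refine ⟨by simp, Or.inl (chainRelB_iff.2 ⟨by omega, Or.inr (Or.inl ⟨by omega, Or.inr rfl⟩)⟩)⟩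

/-- `LR` is a chain edge. [folklore] -/
theorem chainG_adj_slLR {Mc i : ℕ} (hi : i < Mc) : (chainG Mc).Adj (slLR i).1 (slLR i).2 := by
  rw [chainG_adj, slLR]
  refine ⟨by simp, Or.inl (chainRelB_iff.2 ⟨by omega, Or.inr (Or.inr (Or.inr (Or.inl ⟨by omega, rfl⟩)))⟩)⟩

/-- Ends of slot edges of cell `i < Mc` are chain vertices. [folklore] -/
theorem slUL_mem {Mc i : ℕ} (hi : i < Mc) : (slUL i).1 ∈ chainV Mc ∧ (slUL i).2 ∈ chainV Mc := by
  simp [slUL, chainV]; omega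
/-- Ends of `UR` are chain vertices. [folklore] -/
theorem slUR_mem {Mc i : ℕ} (hi : i < Mc) : (slUR i).1 ∈ chainV Mc ∧ (slUR i).2 ∈ chainV Mc := by
  simp [slUR, chainV]; omega
/-- Ends of `LL` are chain vertices. [folklore] -/
theorem slLL_mem {Mc i : ℕ} (hi : i < Mc) : (slLL i).1 ∈ chainV Mc ∧ (slLL i).2 ∈ chainV Mc := by
  simp [slLL, chainV]; omega
/-- Ends of `LR` are chain vertices. [folklore] -/
theorem slLR_mem {Mc i : ℕ} (hi : i < Mc) : (slLR i).1 ∈ chainV Mc ∧ (slLR i).2 ∈ chainV Mc := by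
  simp [slLR, chainV]; omega

/-! ### Decoding a slot edge: the cell and the direction -/

/-- **A cell slot edge determines its cell and direction.** [folklore] -/
theorem slot_decode {i i' : ℕ} :
    (slUL i = slUL i' → i = i') ∧ (slUR i = slUR i' → i = i') ∧ (slLL i = slLL i' → i = i') ∧
      (slLR i = slLR i' → i = i') ∧ slUL i ≠ slUR i' ∧ slUL i ≠ slLL i' ∧ slUL i ≠ slLR i' ∧
      slUR i ≠ slLL i' ∧ slUR i ≠ slLR i' ∧ slLL i ≠ slLR i' := by
  simp only [slUL, slUR, slLL, slLR, Prod.mk.injEq, ne_eq, not_and]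
  omega

/-! ### Previous occurrences -/

/-- The previous occurrence is an earlier cell of the same variable. [folklore] -/
theorem prev?_spec {c d : ℕ} (h : prev? φ c = some d) : d < c ∧ FormulaCells.varOf φ d = FormulaCells.varOf φ c := by
  unfold prev? at h
  have hm := List.mem_of_getLast? h
  rw [List.mem_filter, List.mem_range, decide_eq_true_eq] at hm
  exact hm

/-- At most one of `r = c`, `prev? c = some r`. [folklore] -/
theorem prev?_ne_self {c : ℕ} : prev? φ c ≠ some c := fun h => by
  have := (prev?_spec h).1; omega

end LOTReduction

end Literature.Combinatorics.SimpleGraph
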